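import Summits.CriticalPhenomena.PercolationContinuityZ3.Theorems.Transplant.OrthantUniquenessLink
import Summits.CriticalPhenomena.PercolationContinuityZ3.Theorems.Transplant.OrthantUniquenessExterior
import HarnessLib

/-!
# The all-arms chain of an inner-boundary vertex: stations, constants, the link inequalities, regions inside the orthant

builds on p205010 (kernel theorem, internal audit signed; external expert review pending) — nothing in this file uses p205010.
Lane `prim-bschramm`, seat `prim-bschramm-p2` gen 17 (class C1b); helper file (`--supports stmt-CriticalPhenomena-4575 --as helper`)
for the ORTHANT uniqueness programme (Barsky–Grimmett–Newman 1991, Cor. to Thm 1.1 (iii)/(iv) for `ℤ^{d-ℓ} × ℤ₊^ℓ`, all `ℓ ≥ 1`,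
all `d ≥ 2`).  Continues `OrthantUniquenessLink` (generic links) and `OrthantUniquenessExterior` (the orthant `𝕆_I`, `0 ∈ I`).

THE DESIGN (coordinate canonicalisation).  An inner-boundary vertex `u` of `Λ_N = [-N,N]^d` sits on a face `{x_c = σN}` whose outward
normal points into `𝕆_I` (`FaceOK`).  ESCAPE: `u → corner = u + σ(k+1)e_c → apex` (constrained coordinates lifted to `≥ k`).  LINK 0
(plane `(x_0, x_{i₀})`, `i₀ = c`, or `1` if `c = 0`; sign `σ₀ = σ`, or `1`): steep arm from the apex, port
`station 0 = (H₀; apex_{i₀} + σ₀D₀ at i₀; apex_j)` above the box.  LINKS `n = 1, …, d-1` (plane `(x_0, x_n)`, sign `+1`): from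
`station (n-1)` to `station n = (H_n; C_n at n; previous coordinates)`, the counter-shallow arm running from the canonical value `C_n`
back to the target `0` (constrained `n`) or `-(B+k)` (free `n`), past every possible position of the steep arm.  After the last link
every coordinate is canonical: **`station (d-1) = omega N k` does not depend on `u`** (`station_last`), so two inner-boundary vertices
are joined through `omega`.  Constants (`k` = kit offset): `H₀ = N+2k+2`, `D₀ = H₀+3k+1`, `T₀ = 2H₀+4k+1`, `B = N+k+1+D₀`,
`H_n = H₀ + n(k+1)`, `T_n = 2H_n + 2B + 4k`, `C_n = B + T_n`; they satisfy the link inequalities (`linkOK_zero`, `linkOK_succ`), and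
all regions lie in `𝕆_I` off the box (`link0_good`, `linkS_good`) inside the window `[-M, M]^d`, `M = 2C_{d-1} + k`.
[cite: BarskyGrimmettNewman1991, Comment 6 p. 116, Cor. (iii)] [cite: AizenmanChayesChayesFrohlichRusso1983, §4 Lemma 4.3 and Cor.] -/

noncomputable section

namespace Summit.CriticalPhenomena.PercolationContinuityZ3.Theorems.Transplant

namespace OrthantUniq

open MeasureTheory Literature.Probability.Percolation Literature.Probability.LatticeModels SimpleGraph PlanarCone HSU
open scoped Classical

variable {d : ℕ}

/-! ## §1 Constants -/

section Constants

variable (N k : ℕ)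

/-- Port height of link 0: `H₀ = N + 2k + 2`. [folklore] -/
def H0 : ℕ := N + 2 * k + 2

/-- Port offset of link 0: `D₀ = H₀ + 3k + 1`. [folklore] -/
def D0 : ℕ := H0 N k + 3 * k + 1

/-- Top of link 0: `T₀ = 2H₀ + 4k + 1`. [folklore] -/
def T0 : ℕ := 2 * H0 N k + 4 * k + 1

/-- Bound on the non-canonical coordinates of the stations: `B = N + k + 1 + D₀`. [folklore] -/
def Bc : ℕ := N + k + 1 + D0 N k

/-- Height of station `n`: `H_n = H₀ + n(k+1)`. [folklore] -/
def Hn (n : ℕ) : ℕ := H0 N k + n * (k + 1)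

/-- Top of link `n`: `T_n = 2H_n + 2B + 4k`. [folklore] -/
def Tn (n : ℕ) : ℕ := 2 * Hn N k n + 2 * Bc N k + 4 * k

/-- Canonical value of coordinate `n`: `C_n = B + T_n`. [folklore] -/
def Cn (n : ℕ) : ℕ := Bc N k + Tn N k n

/-- Arithmetic of the constants. [folklore] -/
theorem constants_eqs (n : ℕ) :
    H0 N k = N + 2 * k + 2 ∧ D0 N k = H0 N k + 3 * k + 1 ∧ T0 N k = 2 * H0 N k + 4 * k + 1 ∧ Bc N k = N + k + 1 + D0 N k ∧
      Hn N k n = H0 N k + n * (k + 1) ∧ Tn N k n = 2 * Hn N k n + 2 * Bc N k + 4 * k ∧ Cn N k n = Bc N k + Tn N k n :=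
  ⟨rfl, rfl, rfl, rfl, rfl, rfl, rfl⟩

/-- Monotonicity of `H_n`, `T_n`, `C_n` and the comparisons `H_n ≤ T_n ≤ C_n`, `B ≤ C_n`, `T₀ ≤ C_n`. [folklore] -/
theorem constants_mono {m n : ℕ} (h : m ≤ n) :
    Hn N k m ≤ Hn N k n ∧ Tn N k m ≤ Tn N k n ∧ Cn N k m ≤ Cn N k n ∧ Hn N k n ≤ Tn N k n ∧ Tn N k n ≤ Cn N k n ∧
      Bc N k ≤ Cn N k n ∧ T0 N k ≤ Cn N k n ∧ N + k + 1 ≤ Bc N k ∧ H0 N k ≤ Hn N k n := by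
  have h1 : Hn N k m ≤ Hn N k n := by unfold Hn; nlinarith
  refine ⟨h1, by unfold Tn; omega, by unfold Cn Tn; omega, by unfold Tn; omega, by unfold Cn; omega, by unfold Cn; omega,
    ?_, by unfold Bc; omega, by unfold Hn; nlinarith⟩
  unfold Cn Tn Bc D0 T0 Hn; nlinarith

end Constants

/-- The canonical target of coordinate `j`: `0` for a constrained coordinate, `-(B+k)` for a free one. [folklore] -/
def tco (I : Finset (Fin d)) (N k : ℕ) (j : Fin d) : ℤ := if j ∈ I then 0 else -((Bc N k : ℤ) + k)

/-! ## §2 Face data and the stations -/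

/-- An inner-boundary vertex with its face: `u` on `{x_c = σN}`. [folklore] -/
structure Face (d : ℕ) where
  /-- the vertex -/
  u : Site d
  /-- the face coordinate -/
  c : Fin d
  /-- the outward sign -/
  σ : ℤ

/-- Admissible face data for the box `[-N,N]^d` in the orthant `𝕆_I`: `σ = ±1`, `u ∈ 𝕆_I ∩ [-N,N]^d`, `u_c = σN`, and the outward
normal points into the orthant (`σ = 1` on constrained coordinates). [folklore] -/
def FaceOK (I : Finset (Fin d)) (N : ℕ) (F : Face d) : Prop :=
  (F.σ = 1 ∨ F.σ = -1) ∧ F.u ∈ orth I ∧ F.u ∈ boxSet d N ∧ F.u F.c = F.σ * N ∧ (F.c ∈ I → F.σ = 1)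

/-- The corner `u + σ(k+1)e_c`. [folklore] -/
def corner (N k : ℕ) (F : Face d) : Site d := fun j => if j = F.c then F.σ * (N + k + 1) else F.u j

/-- The apex: the corner with its constrained coordinates lifted to `≥ k`. [folklore] -/
def apex (I : Finset (Fin d)) (N k : ℕ) (F : Face d) : Site d :=
  fun j => if j = F.c then F.σ * (N + k + 1) else if j ∈ I then max (F.u j) k else F.u j

variable [NeZero d]

/-- The plane coordinate of link 0: `c`, or `1` when `c = 0`. [folklore] -/
def plane0 (hd : 2 ≤ d) (c : Fin d) : Fin d := if c = 0 then ⟨1, hd⟩ else c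

/-- The sign of link 0: `σ`, or `1` when `c = 0`. [folklore] -/
def sign0 (F : Face d) : ℤ := if F.c = 0 then 1 else F.σ

/-- The stations: `station 0` is the port of link 0, `station (n+1)` the port of link `n+1` (coordinate `n+1` made canonical).
[folklore] -/
def station (hd : 2 ≤ d) (I : Finset (Fin d)) (N k : ℕ) (F : Face d) : ℕ → Site d
  | 0 => linkPort (apex I N k F) (plane0 hd F.c) (H0 N k) (apex I N k F (plane0 hd F.c) + sign0 F * D0 N k)
  | n + 1 => if h : n + 1 < d then linkPort (station hd I N k F n) ⟨n + 1, h⟩ (Hn N k (n + 1)) (Cn N k (n + 1))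
      else station hd I N k F n

/-- The common terminal `Ω = (H_{d-1}; C_1, …, C_{d-1})`, independent of the boundary vertex. [folklore] -/
def omega (N k : ℕ) : Site d := fun j => if j = 0 then (Hn N k (d - 1) : ℤ) else Cn N k j.val

/-- The window half-width `M = 2C_{d-1} + k`. [folklore] -/
def Mbig (N k : ℕ) : ℕ := Cn N k (d - 1) + Cn N k (d - 1) + k

section Stations

variable (hd : 2 ≤ d) (I : Finset (Fin d)) (N k : ℕ) (F : Face d)

/-- `plane0` is a nonzero coordinate. [folklore] -/
theorem plane0_ne_zero : plane0 hd F.c ≠ 0 := by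
  unfold plane0; split_ifs with h
  · simp [Fin.ext_iff]
  · exact h

/-- `sign0 = ±1`. [folklore] -/
theorem sign0_cases (hσ : F.σ = 1 ∨ F.σ = -1) : sign0 F = 1 ∨ sign0 F = -1 := by
  unfold sign0; split_ifs <;> simp [hσ]

/-- The recursion step of the stations. [folklore] -/
theorem station_succ {n : ℕ} (h : n + 1 < d) :
    station hd I N k F (n + 1) = linkPort (station hd I N k F n) ⟨n + 1, h⟩ (Hn N k (n + 1)) (Cn N k (n + 1)) := by
  rw [station, dif_pos h]

/-- Coordinates of `station 0`. [folklore] -/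
theorem station_zero_apply (j : Fin d) :
    station hd I N k F 0 j = if j = 0 then (H0 N k : ℤ) else if j = plane0 hd F.c then
      apex I N k F (plane0 hd F.c) + sign0 F * D0 N k else apex I N k F j := by
  rw [station, linkPort]

/-- **Coordinates of the stations**: height `H_n`, canonical values `C_j` on `1 ≤ j ≤ n`, the coordinates of `station 0` beyond.
[folklore] -/
theorem station_apply {n : ℕ} (hn : n < d) (j : Fin d) :
    station hd I N k F n j = if j = 0 then (Hn N k n : ℤ) else if 1 ≤ j.val ∧ j.val ≤ n then (Cn N k j.val : ℤ)
      else station hd I N k F 0 j := by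
  induction n with
  | zero =>
    by_cases hj : j = 0
    · subst hj; simp [station_zero_apply, Hn]
    · have : ¬ (1 ≤ j.val ∧ j.val ≤ 0) := by omega
      rw [if_neg hj, if_neg this]
  | succ n ih =>
    rw [station_succ hd I N k F hn, linkPort, ih (by omega)]
    by_cases hj : j = 0
    · subst hj; simp
    · rw [if_neg hj, if_neg hj, if_neg hj]
      by_cases hjn : j = ⟨n + 1, hn⟩
      · subst hjn; simp
      · have hv : j.val ≠ n + 1 := fun h => hjn (Fin.ext h)
        rw [if_neg hjn]
        by_cases h1 : 1 ≤ j.val ∧ j.val ≤ n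
        · rw [if_pos h1, if_pos ⟨h1.1, by omega⟩]
        · have : ¬ (1 ≤ j.val ∧ j.val ≤ n + 1) := fun h => h1 ⟨h.1, by omega⟩
          rw [if_neg h1, if_neg this]

/-- **The last station is the common terminal `Ω`.** [folklore] -/
theorem station_last : station hd I N k F (d - 1) = omega N k := by
  funext j
  rw [station_apply hd I N k F (by omega), omega]
  by_cases hj : j = 0
  · simp [hj]
  · have h1 : 1 ≤ j.val ∧ j.val ≤ d - 1 := by have := Fin.val_ne_zero_iff.mpr hj; have := j.2; omega
    rw [if_neg hj, if_pos h1, if_neg hj]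

variable {I N F}

/-- The apex and the corner (`u ∈ 𝕆_I ∩ [-N,N]^d` on the face `{x_c = σN}`, `σ = 1` on constrained `c`, `0 ∈ I`): values,
lower bounds `≥ k` on constrained coordinates, the bound `N + k + 1`, membership in `𝕆_I`, and `|apex - corner|_∞ ≤ k`. [folklore] -/
theorem apex_facts (hF : FaceOK I N F) (hI0 : (0 : Fin d) ∈ I) :
    apex I N k F F.c = F.σ * (N + k + 1) ∧ (∀ j, j ≠ F.c → j ∈ I → apex I N k F j = max (F.u j) k) ∧
    (∀ j, j ≠ F.c → j ∉ I → apex I N k F j = F.u j) ∧ (∀ j ∈ I, (k : ℤ) ≤ apex I N k F j) ∧ (k : ℤ) ≤ apex I N k F 0 ∧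
    apex I N k F 0 ≤ N + k + 1 ∧ (∀ j, |apex I N k F j| ≤ N + k + 1) ∧ apex I N k F ∈ orth I ∧ corner N k F ∈ orth I ∧
    (∀ j, |apex I N k F j - corner N k F j| ≤ k) ∧ (∀ j, j ≠ F.c → corner N k F j = F.u j) ∧
    corner N k F F.c = F.σ * (N + k + 1) := by
  obtain ⟨hσ, huO, hubox, huc, hcI⟩ := hF
  have hub : ∀ j, -(N : ℤ) ≤ F.u j ∧ F.u j ≤ N := mem_boxSet_iff.1 hubox
  have hc : apex I N k F F.c = F.σ * (N + k + 1) := by simp [apex]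
  have hI : ∀ j, j ≠ F.c → j ∈ I → apex I N k F j = max (F.u j) k := fun j hj hjI => by simp [apex, hj, hjI]
  have hnI : ∀ j, j ≠ F.c → j ∉ I → apex I N k F j = F.u j := fun j hj hjI => by simp [apex, hj, hjI]
  have hcc : corner N k F F.c = F.σ * (N + k + 1) := by simp [corner]
  have hcr : ∀ j, j ≠ F.c → corner N k F j = F.u j := fun j hj => by simp [corner, hj]
  have hge : ∀ j ∈ I, (k : ℤ) ≤ apex I N k F j := by
    intro j hj
    by_cases hjc : j = F.c
    · rw [hjc, hc, hcI (hjc ▸ hj), one_mul]; omega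
    · rw [hI j hjc hj]; exact le_max_right _ _
  have habs : ∀ j, |apex I N k F j| ≤ N + k + 1 := by
    intro j
    by_cases hjc : j = F.c
    · rw [hjc, hc]; rcases hσ with h | h <;> rw [h]
      · rw [one_mul, abs_of_nonneg (by positivity)]
      · rw [neg_one_mul, abs_neg, abs_of_nonneg (by positivity)]
    · by_cases hjI : j ∈ I
      · rw [hI j hjc hjI, abs_le]; have := hub j
        exact ⟨le_trans (by omega) (le_max_left _ _), max_le (by omega) (by omega)⟩
      · rw [hnI j hjc hjI, abs_le]; have := hub j; omega
  have hcO : corner N k F ∈ orth I := by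
    intro j hj
    by_cases hjc : j = F.c
    · rw [hjc, hcc, hcI (hjc ▸ hj), one_mul]; positivity
    · rw [hcr j hjc]; exact huO j hj
  have hdiff : ∀ j, |apex I N k F j - corner N k F j| ≤ k := by
    intro j
    by_cases hjc : j = F.c
    · rw [hjc, hc, hcc, sub_self, abs_zero]; positivity
    · by_cases hjI : j ∈ I
      · rw [hI j hjc hjI, hcr j hjc, abs_le]; have := huO j hjI
        constructor
        · have := le_max_left (F.u j) (k : ℤ); omega
        · have : max (F.u j) (k : ℤ) ≤ F.u j + k := max_le (by omega) (by omega)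
          omega
      · rw [hnI j hjc hjI, hcr j hjc, sub_self, abs_zero]; positivity
  refine ⟨hc, hI, hnI, hge, hge 0 hI0, ?_, habs, fun j hj => le_trans (by positivity) (hge j hj), hcO, hdiff, hcr, hcc⟩
  have := habs 0; rw [abs_le] at this; exact this.2

/-- The port coordinate of link 0: `apex_{i₀} + σ₀ D₀`. [folklore] -/
def c0 (hd : 2 ≤ d) (I : Finset (Fin d)) (N k : ℕ) (F : Face d) : ℤ := apex I N k F (plane0 hd F.c) + sign0 F * D0 N k

/-- The target of link 0: `apex_{i₀} - σ₀ k`. [folklore] -/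
def t0 (hd : 2 ≤ d) (I : Finset (Fin d)) (N k : ℕ) (F : Face d) : ℤ := apex I N k F (plane0 hd F.c) - sign0 F * k

/-- `sign0 = 1` whenever the plane coordinate of link 0 is constrained. [folklore] -/
theorem sign0_eq_one_of_mem (hF : FaceOK I N F) (h : plane0 hd F.c ∈ I) : sign0 F = 1 := by
  unfold sign0; unfold plane0 at h
  split_ifs at h ⊢ with hc
  · rfl
  · exact hF.2.2.2.2 h

/-- **`station 0`**: height `H₀`, the shifted plane coordinate, the apex elsewhere; constrained coordinates `≥ k`; all coordinates
bounded by `B` off the height. [folklore] -/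
theorem station_zero_facts (hF : FaceOK I N F) (hI0 : (0 : Fin d) ∈ I) :
    station hd I N k F 0 0 = H0 N k ∧ station hd I N k F 0 (plane0 hd F.c) = c0 hd I N k F ∧
    (∀ j, j ≠ 0 → j ≠ plane0 hd F.c → station hd I N k F 0 j = apex I N k F j) ∧
    (∀ j ∈ I, j ≠ 0 → (k : ℤ) ≤ station hd I N k F 0 j) ∧ (∀ j, j ≠ 0 → |station hd I N k F 0 j| ≤ Bc N k) := by
  have hp0 := plane0_ne_zero hd F
  obtain ⟨-, -, -, hge, -, -, habs, -⟩ := apex_facts k hF hI0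
  have h00 : station hd I N k F 0 0 = H0 N k := by rw [station_zero_apply, if_pos rfl]
  have hpp : station hd I N k F 0 (plane0 hd F.c) = c0 hd I N k F := by rw [station_zero_apply, if_neg hp0, if_pos rfl, c0]
  have hrest : ∀ j, j ≠ 0 → j ≠ plane0 hd F.c → station hd I N k F 0 j = apex I N k F j := fun j hj0 hjp => by
    rw [station_zero_apply, if_neg hj0, if_neg hjp]
  have hBc : (Bc N k : ℤ) = N + k + 1 + D0 N k := by simp [Bc]
  refine ⟨h00, hpp, hrest, fun j hjI hj0 => ?_, fun j hj0 => ?_⟩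
  · by_cases hjp : j = plane0 hd F.c
    · rw [hjp, hpp, c0, sign0_eq_one_of_mem hd hF (hjp ▸ hjI), one_mul]
      have := hge _ (hjp ▸ hjI); have : (0 : ℤ) ≤ D0 N k := by positivity
      omega
    · rw [hrest j hj0 hjp]; exact hge j hjI
  · by_cases hjp : j = plane0 hd F.c
    · rw [hjp, hpp, c0, hBc]
      have h1 := habs (plane0 hd F.c); rw [abs_le] at h1
      rcases sign0_cases F hF.1 with h | h <;> rw [h, abs_le] <;> constructor <;> omega
    · rw [hrest j hj0 hjp, hBc]; exact (habs j).trans (le_add_of_nonneg_right (by positivity))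

/-- **Stations `n < d`**: height `H_n`; canonical value `C_j` on `1 ≤ j ≤ n`; `station 0` beyond `n`; constrained coordinates `≥ k`;
all coordinates bounded by `C_{d-1}`. [folklore] -/
theorem station_facts (hF : FaceOK I N F) (hI0 : (0 : Fin d) ∈ I) {n : ℕ} (hn : n < d) :
    station hd I N k F n 0 = Hn N k n ∧ (∀ j : Fin d, j ≠ 0 → n < j.val → station hd I N k F n j = station hd I N k F 0 j) ∧
    (∀ j : Fin d, 1 ≤ j.val → j.val ≤ n → station hd I N k F n j = Cn N k j.val) ∧
    (∀ j ∈ I, j ≠ 0 → (k : ℤ) ≤ station hd I N k F n j) ∧ (∀ j, |station hd I N k F n j| ≤ Cn N k (d - 1)) := by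
  obtain ⟨-, -, -, hge0, habs0⟩ := station_zero_facts hd k hF hI0
  have hA := fun j => station_apply hd I N k F hn j
  have h0 : station hd I N k F n 0 = Hn N k n := by rw [hA 0, if_pos rfl]
  have hrest : ∀ j : Fin d, j ≠ 0 → n < j.val → station hd I N k F n j = station hd I N k F 0 j := fun j hj0 hnj => by
    rw [hA j, if_neg hj0, if_neg (by omega)]
  have hcan : ∀ j : Fin d, 1 ≤ j.val → j.val ≤ n → station hd I N k F n j = Cn N k j.val := fun j hj1 hjn => by
    have hj0 : j ≠ 0 := fun h => by rw [h] at hj1; simp at hj1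
    rw [hA j, if_neg hj0, if_pos ⟨hj1, hjn⟩]
  refine ⟨h0, hrest, hcan, fun j hjI hj0 => ?_, fun j => ?_⟩
  · by_cases hjn : j.val ≤ n
    · rw [hcan j (by have := Fin.val_ne_zero_iff.mpr hj0; omega) hjn]
      have := (constants_mono N k (le_refl j.val)).2.2.2.2.2.1; have : N + k + 1 ≤ Bc N k := (constants_mono N k (le_refl 0)).2.2.2.2.2.2.2.1
      omega
    · rw [hrest j hj0 (by omega)]; exact hge0 j hjI hj0
  · obtain ⟨m1, m2, m3, m4, m5, m6, m7, m8, m9⟩ := constants_mono N k (show n ≤ d - 1 by omega)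
    by_cases hj0 : j = 0
    · rw [hj0, h0, Nat.abs_cast]; exact_mod_cast m1.trans m4 |>.trans m5
    · by_cases hjn : j.val ≤ n
      · rw [hcan j (by have := Fin.val_ne_zero_iff.mpr hj0; omega) hjn, Nat.abs_cast]
        exact_mod_cast (constants_mono N k (show j.val ≤ d - 1 by omega)).2.2.1
      · rw [hrest j hj0 (by omega)]
        exact (habs0 j hj0).trans (by exact_mod_cast m6)

/-! ## §3 The link inequalities hold -/

/-- **Link 0 satisfies the link inequalities.** [folklore] -/
theorem linkOK_zero (hF : FaceOK I N F) (hI0 : (0 : Fin d) ∈ I) :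
    LinkOK k (apex I N k F) (plane0 hd F.c) (sign0 F) (H0 N k) (c0 hd I N k F) (T0 N k) (t0 hd I N k F) := by
  obtain ⟨-, -, -, -, h0k, h0N, -⟩ := apex_facts k hF hI0
  have hs := sign0_cases F hF.1
  have hss : sign0 F * sign0 F = 1 := by rcases hs with h | h <;> rw [h] <;> norm_num
  have e1 : sign0 F * (c0 hd I N k F - apex I N k F (plane0 hd F.c)) = D0 N k := by
    rw [c0, show apex I N k F (plane0 hd F.c) + sign0 F * (D0 N k : ℤ) - apex I N k F (plane0 hd F.c) = sign0 F * D0 N k by ring,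
      ← mul_assoc, hss, one_mul]
  have e2 : sign0 F * t0 hd I N k F = sign0 F * apex I N k F (plane0 hd F.c) - k := by
    rw [t0, mul_sub, ← mul_assoc, hss, one_mul]
  have e3 : sign0 F * (c0 hd I N k F - t0 hd I N k F) = D0 N k + k := by
    rw [mul_sub, e2, c0, mul_add, ← mul_assoc, hss, one_mul]; ring
  have hH0 : (H0 N k : ℤ) = N + 2 * k + 2 := by simp [H0]
  have hD0 : (D0 N k : ℤ) = H0 N k + 3 * k + 1 := by simp [D0]
  have hT0 : (T0 N k : ℤ) = 2 * H0 N k + 4 * k + 1 := by simp [T0]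
  refine ⟨plane0_ne_zero hd F, hs, by omega, ?_, by rw [e2]; omega, ?_⟩
  · rw [e1]; omega
  · rw [e3]; omega

/-- **Link `n+1` satisfies the link inequalities** (`n + 1 < d`). [folklore] -/
theorem linkOK_succ (hF : FaceOK I N F) (hI0 : (0 : Fin d) ∈ I) {n : ℕ} (h : n + 1 < d) :
    LinkOK k (station hd I N k F n) ⟨n + 1, h⟩ 1 (Hn N k (n + 1)) (Cn N k (n + 1)) (Tn N k (n + 1)) (tco I N k ⟨n + 1, h⟩) := by
  obtain ⟨h0, hrest, -, hge, -⟩ := station_facts hd k hF hI0 (show n < d by omega)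
  obtain ⟨-, -, -, hge0, habs0⟩ := station_zero_facts hd k hF hI0
  have hj0 : (⟨n + 1, h⟩ : Fin d) ≠ 0 := by simp [Fin.ext_iff]
  have hbi : station hd I N k F n ⟨n + 1, h⟩ = station hd I N k F 0 ⟨n + 1, h⟩ := hrest _ hj0 (by simp)
  have hB := habs0 ⟨n + 1, h⟩ hj0; rw [abs_le] at hB
  have hHn : (Hn N k (n + 1) : ℤ) = Hn N k n + k + 1 := by simp [Hn]; ring
  have hTn : (Tn N k (n + 1) : ℤ) = 2 * Hn N k (n + 1) + 2 * Bc N k + 4 * k := by simp [Tn]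
  have hCn : (Cn N k (n + 1) : ℤ) = Bc N k + Tn N k (n + 1) := by simp [Cn]
  have hHnn : (0 : ℤ) ≤ Hn N k n := by positivity
  refine ⟨hj0, Or.inl rfl, by rw [h0]; omega, ?_, ?_, ?_⟩
  · rw [h0, hbi, one_mul]; omega
  · rw [one_mul, one_mul, hbi, tco]
    split_ifs with hI
    · have := hge0 _ hI hj0; omega
    · omega
  · rw [one_mul, tco]
    split_ifs with hI <;> omega

end Stations

end OrthantUniq

end Summit.CriticalPhenomena.PercolationContinuityZ3.Theorems.Transplant

end
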